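import Literature.Probability.FitznerVanDerHofstad2017.NobleBlocksAvgPerc
import Literature.Probability.FitznerVanDerHofstad2017.NobleBlocksDoublePrime
import HarnessLib

/-!
# Support lemmas for the additive family `Ā''` (§6.1-typed row `(0,2)`): covariance, class-`1̲` support, averaged summation

[FvdH17] §6.1 "Bound in terms of diagrams: N ≥ 1", Case `a = 0, b ≥ 2` (arXiv:1506.07977v2 p. 59, l.9918–9922 of the
source) types the entry `(ι,0,2)` of the un-starred `Ā^ι` by the REPULSIVE triangle `𝓣_{1,1̲,0}(u−z, u+e_ι−z, t−z)`;
`NobleBlocksDoublePrime` adds that row as the family `blockAbar'' ∕ matAbarIota''` next to the landed `Ā'`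
(`NobleBlocksPrime`, App. B (B.5c) p. 78 row with `𝓣*`).  This module is the `''`-twin of the un-starred halves of
`NobleBlocksCovClosed` §Primed, `NobleBlocksPercSupport` §D–§E and `NobleBlocksAvgPerc` §Bridge — every statement
below is the landed `Ā'` statement with `blockAbar''` for `blockAbar'` (and `matAbarIota''` for `matAbarIota'`),
re-proved in the kernel; nothing is inherited from an `Ā'` theorem:

* §A  `W_d`-covariance: `perc_blockAbar₀''_signedPerm`, `perc_blockAbar''_signedPerm`, `sum_perc_blockAbar''_signedPerm`,
  `isCov₄_sum_perc_blockAbar''` (row `(0,2)`: `perc_T_signedPerm` where the `𝓣*` row used `perc_Tst_signedPerm`);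
* §B  the class-`1̲` support hypotheses `hAin` ∕ `hAout` of the averaged summation (rows `a = 1` ∕ columns `b = 1`
  never meet `(0,2)`, so they transfer through `blockAbar''_of_ne`) and the two averaged summation lemmas
  ((6.4) ⇒ (6.5), (6.51) ⇒ (5.34));
* §C  the five `NobleBlocksAvgPerc` bridge specialisations at `A = blockAbar''` and `Ā''_avg ≤ (Ā''^ι)` entrywise.

The starred family (`blockAbarSt'`, §5.1 Table p. 47: non-repulsive for `b ≠ 0`) is untouched and not restated.
Discrepancy record: programme note D68 (App. B (B.5c) vs §6.1) — the reason for the additive typing, not a fact.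
-/

noncomputable section

namespace Literature.Probability.FitznerVanDerHofstad2017.NobleBlocks

open Literature.Probability.LatticeModels Literature.Probability.Percolation
open Literature.Probability.FitznerVanDerHofstad2017.BlockSummation
open Literature.Barriers.CriticalPhenomena (signedPerm_sub signedPerm_neg nobleXiIotaN)
open scoped BigOperators ENNReal Matrix

variable {d : ℕ}

/-! ## §A. `W_d`-covariance of the `''` family (twin of `NobleBlocksCovClosed` §Primed, un-starred half) -/

section Cov

variable (p : unitInterval) (π : Equiv.Perm (Fin d)) (ε : Fin d → ℤˣ) {ρ : Fin d × Bool → Fin d × Bool}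

/-- `Ā''^{ρκ,a,b}(0, σ·) = Ā''^{κ,a,b}(0, ·)`: the §6.1 row `(0,2)` (`δ · 𝓣_{1,1̲,0}`) is covariant with the direction
permuted along (`perc_T_signedPerm`); the other rows are those of `Ā'`.
[cite: FitznerVanDerHofstad2017, §6.1 Case a = 0, b ≥ 2 (arXiv:1506.07977v2 p. 59); App. B (p. 78); §3.5 (p. 32)] -/
theorem perc_blockAbar₀''_signedPerm (hρ : ∀ κ, Site.signedPerm π ε (stepVec κ) = stepVec (ρ κ)) (κ : Fin d × Bool)
    (a b : Fin 3) (v x y : Site d) :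
    blockAbar₀'' (Letters.perc d p) (ρ κ) a b (Site.signedPerm π ε v) (Site.signedPerm π ε x)
      (Site.signedPerm π ε y) = blockAbar₀'' (Letters.perc d p) κ a b v x y := by
  by_cases h : a = 0 ∧ b = 2
  · obtain ⟨rfl, rfl⟩ := h
    simp only [blockAbar₀''_zero_two, ← hρ, kd_signedPerm_zero, ← signedPerm_neg, ← signedPerm_sub,
      perc_T_signedPerm]
  · rw [blockAbar₀''_of_ne _ _ h, blockAbar₀''_of_ne _ _ h, perc_blockAbar₀'_signedPerm p π ε hρ]

/-- `Ā''^{ρκ,a,b}(σ·) = Ā''^{κ,a,b}(·)` (general base point).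
[cite: FitznerVanDerHofstad2017, §6.1 Case a = 0, b ≥ 2 (arXiv:1506.07977v2 p. 59); App. B (p. 78)] -/
theorem perc_blockAbar''_signedPerm (hρ : ∀ κ, Site.signedPerm π ε (stepVec κ) = stepVec (ρ κ)) (κ : Fin d × Bool)
    (a b : Fin 3) (u v x y : Site d) :
    blockAbar'' (Letters.perc d p) (ρ κ) a b (Site.signedPerm π ε u) (Site.signedPerm π ε v)
      (Site.signedPerm π ε x) (Site.signedPerm π ε y) = blockAbar'' (Letters.perc d p) κ a b u v x y := by
  simp only [blockAbar'', ofBase, ← signedPerm_sub, perc_blockAbar₀''_signedPerm p π ε hρ]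

/-- **`Σ_κ Ā''^{κ,a,b}(σ·) = Σ_κ Ā''^{κ,a,b}(·)`**.
[cite: FitznerVanDerHofstad2017, §6.1 Case a = 0, b ≥ 2 (arXiv:1506.07977v2 p. 59); App. B (p. 78)] -/
theorem sum_perc_blockAbar''_signedPerm (a b : Fin 3) (u v x y : Site d) :
    ∑ κ, blockAbar'' (Letters.perc d p) κ a b (Site.signedPerm π ε u) (Site.signedPerm π ε v)
        (Site.signedPerm π ε x) (Site.signedPerm π ε y) = ∑ κ, blockAbar'' (Letters.perc d p) κ a b u v x y := by
  obtain ⟨σ, hσ⟩ := exists_stepVec_perm π ε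
  rw [← Equiv.sum_comp σ (fun κ => blockAbar'' (Letters.perc d p) κ a b (Site.signedPerm π ε u)
    (Site.signedPerm π ε v) (Site.signedPerm π ε x) (Site.signedPerm π ε y))]
  exact Finset.sum_congr rfl fun κ _ => perc_blockAbar''_signedPerm p π ε hσ κ a b u v x y

omit π ε in
/-- `Σ_κ Ā''^{κ,a,b}` is `W_d`-covariant. [cite: FitznerVanDerHofstad2017, §6.1 p. 59 (arXiv:1506.07977v2); §3.5 (p. 32)] -/
theorem isCov₄_sum_perc_blockAbar'' (a b : Fin 3) :
    IsCov₄ (signedPermAddEquivs d) (fun u v x y => ∑ κ, blockAbar'' (Letters.perc d p) κ a b u v x y) :=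
  isCov₄_signedPermAddEquivs_iff.2 fun π ε u v x y => sum_perc_blockAbar''_signedPerm p π ε a b u v x y

end Cov

/-! ## §B. Class-`1̲` support and the averaged summation (twin of `NobleBlocksPercSupport` §D–§E, un-starred half) -/

section Support

variable (p : unitInterval)

/-- **`hAin` for `Ā''`**: `Ā''^{κ,a,b}(0,v,x,y) = 0` for `a = 1` and `v ∉ unitVecs d` (row `a = 1` is a row of `Ā'`).
[cite: FitznerVanDerHofstad2017, §6.1 p. 59 "we include the information that … u, w … are neighbors" (arXiv:1506.07977v2)] -/
theorem perc_blockAbar''_hAin (κ : Fin d × Bool) (a b : Fin 3) (ha : decide (a = 1) = true) (v x y : Site d)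
    (hv : v ∉ unitVecs d) : blockAbar'' (Letters.perc d p) κ a b 0 v x y = 0 := by
  obtain rfl : a = 1 := of_decide_eq_true ha
  rw [blockAbar''_of_ne _ κ (fun h => absurd h.1 (by decide))]
  exact perc_blockAbar'_hAin p κ 1 b rfl v x y hv

/-- **`hAout` for `Ā''`**: `Ā''^{κ,a,b}(0,v,x,y) = 0` for `b = 1` and `y − x ∉ unitVecs d` (column `b = 1` is a column
of `Ā'`). [cite: FitznerVanDerHofstad2017, §6.1 p. 59 "we include the information that … z, t are neighbors" (arXiv:1506.07977v2)] -/
theorem perc_blockAbar''_hAout (κ : Fin d × Bool) (a b : Fin 3) (hb : decide (b = 1) = true) (v x y : Site d)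
    (hxy : y - x ∉ unitVecs d) : blockAbar'' (Letters.perc d p) κ a b 0 v x y = 0 := by
  obtain rfl : b = 1 := of_decide_eq_true hb
  rw [blockAbar''_of_ne _ κ (fun h => absurd h.2 (by decide))]
  exact perc_blockAbar'_hAout p κ a 1 rfl v x y hxy

/-- **(6.4) ⇒ (6.5) with the class-`1̲`-averaged element `Ā''_avg`, for bond percolation on `ℤ^d`.**
[cite: FitznerVanDerHofstad2017, Lemma 5.2 with §6.1 (6.4)–(6.5) and p. 59 (arXiv:1506.07977v2 pp. 50, 58–59)] -/
theorem tsum_le_vecPS_matAbarAvg''_vecPE_perc (Ξ : Site d → ℝ≥0∞)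
    (hΞ : ∀ x, Ξ x ≤ ∑' u, ∑' w, ∑' t, ∑' z, ∑ κ : Fin d × Bool, ∑ a : Fin 3, ∑ b : Fin 3,
      blockPS (Letters.perc d p) a u w * blockAbar'' (Letters.perc d p) κ a b u w t z *
        blockPE (Letters.perc d p) b (t - x) (z - x)) :
    ∑' x, Ξ x ≤ vecPS (Letters.perc d p) ᵥ*
      matAbarAvg (unitVecs d) (fun a : Fin 3 => decide (a = 1)) (blockAbar'' (Letters.perc d p)) ⬝ᵥ
        vecPE (Letters.perc d p) :=
  perc_tsum_le_vecPS_matAbarAvg_vecPE_of p (isTransInv_blockAbar'' (Letters.perc d p)) (perc_blockAbar''_hAin p)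
    (perc_blockAbar''_hAout p) Ξ hΞ

/-- **(6.51) ⇒ (5.34) with the class-`1̲`-averaged element `Ā''_avg`, for bond percolation on `ℤ^d`**
(`P^{(M)} = recP P^S B^{Full}`, exit order `P^{E,b}(z−x,t−x)`).
[cite: FitznerVanDerHofstad2017, Prop. 5.5 (5.34) and Lemma 6.1 (6.51) with §6.1 p. 59 (arXiv:1506.07977v2 pp. 53, 59, 65)] -/
theorem tsum_le_vecMul_pow_matAbarAvg''_perc (M : ℕ) (Ξ : Site d → ℝ≥0∞)
    (hΞ : ∀ x, Ξ x ≤ ∑' u, ∑' w, ∑' t, ∑' z, ∑ κ : Fin d × Bool, ∑ a : Fin 3, ∑ b : Fin 3,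
      recP (blockPS (Letters.perc d p)) (blockBFull (Letters.perc d p)) M a u w *
        blockAbar'' (Letters.perc d p) κ a b u w t z * blockPE (Letters.perc d p) b (z - x) (t - x)) :
    ∑' x, Ξ x ≤ vecP (blockPS (Letters.perc d p)) ᵥ* matB (blockBFull (Letters.perc d p)) ^ M ᵥ*
      matAbarAvg (unitVecs d) (fun a : Fin 3 => decide (a = 1)) (blockAbar'' (Letters.perc d p)) ⬝ᵥ
        vecP (blockPE (Letters.perc d p)) :=
  perc_tsum_le_vecPS_pow_matAbarAvg_vecPE_of p (isTransInv_blockAbar'' (Letters.perc d p)) (perc_blockAbar''_hAin p)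
    (perc_blockAbar''_hAout p) Ξ M hΞ

end Support

/-! ## §C. The `NobleBlocksAvgPerc` bridge at `A = Ā''` (twin of its `blockAbar'` specialisations) -/

section Bridge

variable (p : unitInterval)

/-- **(BoundXiIotaOne-1) for bond percolation, `ι`-averaged with the trivial term, averaged element `Ā''_avg`.**
[cite: FitznerVanDerHofstad2017, Lemma 5.3 (BoundXiIotaOne-1) (arXiv:1506.07977v2 p. 50); §6.1 (p. 59); §5.1 p. 49] -/
theorem perc_invTwoD_mul_sum_tsum_le_vecPiota_matAbarAvg''_vecPE (Ξι : Fin d × Bool → Site d → ℝ≥0∞)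
    (hΞ : ∀ ι x, Ξι ι x ≤ ∑' u, ∑' w, ∑' t, ∑' z, ∑ κ : Fin d × Bool, ∑ a : Fin 3, ∑ b : Fin 3,
      (kdeltaPref ι κ a u w + blockPiota (Letters.perc d p) ι a u w) * blockAbar'' (Letters.perc d p) κ a b u w t z *
        blockPE (Letters.perc d p) b (t - x) (z - x)) :
    invTwoD d * ∑ ι : Fin d × Bool, ∑' x, Ξι ι x ≤
      vecPiota (Letters.perc d p) ᵥ* matAbarAvg (unitVecs d) (fun a : Fin 3 => decide (a = 1))
        (blockAbar'' (Letters.perc d p)) ⬝ᵥ vecPE (Letters.perc d p) :=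
  perc_invTwoD_mul_sum_tsum_le_vecPiota_matAbarAvg_vecPE_of p (isTransInv_blockAbar'' (Letters.perc d p))
    (perc_blockAbar''_hAin p) (perc_blockAbar''_hAout p) Ξι hΞ

/-- **(BoundXiIotaOne-1) for bond percolation, fixed direction under symmetry, averaged element `Ā''_avg`.**
[cite: FitznerVanDerHofstad2017, Lemma 5.3 (BoundXiIotaOne-1) (arXiv:1506.07977v2 p. 50); §6.1 (p. 59); §3.5 (p. 30)] -/
theorem perc_tsum_le_vecPiota_matAbarAvg''_vecPE_of_symm (Ξι : Fin d × Bool → Site d → ℝ≥0∞)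
    (hΞ : ∀ ι x, Ξι ι x ≤ ∑' u, ∑' w, ∑' t, ∑' z, ∑ κ : Fin d × Bool, ∑ a : Fin 3, ∑ b : Fin 3,
      (kdeltaPref ι κ a u w + blockPiota (Letters.perc d p) ι a u w) * blockAbar'' (Letters.perc d p) κ a b u w t z *
        blockPE (Letters.perc d p) b (t - x) (z - x))
    (ι₀ : Fin d × Bool) (hsym : ∀ ι, ∑' x, Ξι ι x = ∑' x, Ξι ι₀ x) :
    ∑' x, Ξι ι₀ x ≤ vecPiota (Letters.perc d p) ᵥ* matAbarAvg (unitVecs d) (fun a : Fin 3 => decide (a = 1))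
      (blockAbar'' (Letters.perc d p)) ⬝ᵥ vecPE (Letters.perc d p) :=
  perc_tsum_le_vecPiota_matAbarAvg_vecPE_of_symm_of p (isTransInv_blockAbar'' (Letters.perc d p))
    (perc_blockAbar''_hAin p) (perc_blockAbar''_hAout p) Ξι hΞ ι₀ hsym

/-- **(BoundXiIotaOne-1) for `Ξ^{(N),ι}_p` with the averaged element `Ā''_avg`**: if `Ξ^{(N),ι}_p` obeys the
`x`-space bound with `blockAbar''` for every `ι`, then `Σ_x Ξ^{(N),ι₀}_p(x) ≤ P⃗^ι (Ā''_avg) P⃗^E` for every `ι₀`.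
[cite: FitznerVanDerHofstad2017, Lemma 5.3 (BoundXiIotaOne-1) (arXiv:1506.07977v2 p. 50); §6.1 (p. 59); §3.5 (p. 30)] -/
theorem perc_tsum_ofReal_nobleXiIotaN_le_vecPiota_matAbarAvg''_vecPE (N : ℕ)
    (hΞ : ∀ ι x, ENNReal.ofReal (nobleXiIotaN d p (stepVec ι) N x)
      ≤ ∑' u, ∑' w, ∑' t, ∑' z, ∑ κ : Fin d × Bool, ∑ a : Fin 3, ∑ b : Fin 3,
        (kdeltaPref ι κ a u w + blockPiota (Letters.perc d p) ι a u w) * blockAbar'' (Letters.perc d p) κ a b u w t z *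
          blockPE (Letters.perc d p) b (t - x) (z - x))
    (ι₀ : Fin d × Bool) :
    ∑' x, ENNReal.ofReal (nobleXiIotaN d p (stepVec ι₀) N x) ≤
      vecPiota (Letters.perc d p) ᵥ* matAbarAvg (unitVecs d) (fun a : Fin 3 => decide (a = 1))
        (blockAbar'' (Letters.perc d p)) ⬝ᵥ vecPE (Letters.perc d p) :=
  perc_tsum_le_vecPiota_matAbarAvg''_vecPE_of_symm p (fun ι x => ENNReal.ofReal (nobleXiIotaN d p (stepVec ι) N x))
    hΞ ι₀ fun ι => tsum_ofReal_nobleXiIotaN_exch p N ι ι₀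

/-- **(5.34) for bond percolation with the averaged terminal element `Ā''_avg`, exit order (6.4).**
[cite: FitznerVanDerHofstad2017, Prop. 5.5 (5.34) (arXiv:1506.07977v2 p. 53); §6.2.1 (pp. 65–67); §6.1 p. 59; §5.1 p. 49] -/
theorem perc_tsum_le_vecPS_pow_matAbarAvg''_vecPE' (Ξ : Site d → ℝ≥0∞) (M : ℕ)
    (hΞ : ∀ x, Ξ x ≤ ∑' u, ∑' w, ∑' t, ∑' z, ∑ κ : Fin d × Bool, ∑ a : Fin 3, ∑ b : Fin 3,
      recP (blockPS (Letters.perc d p)) (blockBFull (Letters.perc d p)) M a u w * blockAbar'' (Letters.perc d p) κ a b u w t z *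
        blockPE (Letters.perc d p) b (t - x) (z - x)) :
    ∑' x, Ξ x ≤ vecPS (Letters.perc d p) ᵥ* matB (blockBFull (Letters.perc d p)) ^ M ᵥ*
      matAbarAvg (unitVecs d) (fun a : Fin 3 => decide (a = 1)) (blockAbar'' (Letters.perc d p)) ⬝ᵥ vecPE (Letters.perc d p) :=
  perc_tsum_le_vecPS_pow_matAbarAvg_vecPE_of' p (isTransInv_blockAbar'' (Letters.perc d p)) (perc_blockAbar''_hAin p)
    (perc_blockAbar''_hAout p) Ξ M hΞ

/-- **(5.37) for bond percolation, `ι`-summed with the trivial term, averaged terminal element `Ā''_avg`.**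
[cite: FitznerVanDerHofstad2017, Prop. 5.6 (5.37) (arXiv:1506.07977v2 p. 53); §6.2.1 (pp. 65–67); §6.1 (p. 59); §5.1 p. 49] -/
theorem perc_invTwoD_mul_sum_tsum_le_vecPiota_pow_matAbarAvg''_vecPE (Ξι : Fin d × Bool → Site d → ℝ≥0∞) (M : ℕ)
    (hΞ : ∀ x, ∑ ι : Fin d × Bool, Ξι ι x ≤ ∑' u, ∑' w, ∑' t, ∑' z, ∑ κ : Fin d × Bool, ∑ a : Fin 3, ∑ b : Fin 3,
      recP (piotaFull (Letters.perc d p)) (blockBFull (Letters.perc d p)) M a u w * blockAbar'' (Letters.perc d p) κ a b u w t z *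
        blockPE (Letters.perc d p) b (t - x) (z - x)) :
    invTwoD d * ∑ ι : Fin d × Bool, ∑' x, Ξι ι x ≤
      vecPiota (Letters.perc d p) ᵥ* (matB (blockBFull (Letters.perc d p)) ^ M *
        matAbarAvg (unitVecs d) (fun a : Fin 3 => decide (a = 1)) (blockAbar'' (Letters.perc d p))) ⬝ᵥ vecPE (Letters.perc d p) :=
  perc_invTwoD_mul_sum_tsum_le_vecPiota_pow_matAbarAvg_vecPE_of p (isTransInv_blockAbar'' (Letters.perc d p))
    (perc_blockAbar''_hAin p) (perc_blockAbar''_hAout p) Ξι M hΞ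

omit p in
/-- The averaged element `Ā''_avg` is entrywise below `(Ā''^ι) = matAbarIota'' L`.
[cite: FitznerVanDerHofstad2017, §5.1 "Elements of the bounds" (arXiv:1506.07977v2 p. 49); §6.1 (p. 59)] -/
theorem matAbarAvg_blockAbar''_le_matAbarIota'' (L : Letters d) (a b : Fin 3) :
    matAbarAvg (unitVecs d) (fun a : Fin 3 => decide (a = 1)) (blockAbar'' L) a b ≤ matAbarIota'' L a b :=
  matAbarAvg_le_matAbar (unitVecs d) _ (blockAbar'' L) a b

end Bridge

end Literature.Probability.FitznerVanDerHofstad2017.NobleBlocks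

end
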